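import Mathlib.Topology.Order.IntermediateValue
import Literature.MathematicalPhysics.QuantumLattice.SpectroscopicGapRatio
import Literature.MathematicalPhysics.QuantumLattice.PreslandTallonParabola
import HarnessLib

/-!
# The two printed gap-energy lines of Hüfner–Hossain–Damascelli–Sawatzky (REFVALS-2 §139)

[HuefnerEtAl2008TwoGapsReview, Fig. 2 caption and Table 1] compile, for the hole-doped cuprates with
`T_c^max ∼ 95 K` (Bi2212, Y123, Tl2201, Hg1201), the pseudogap scale `E_pg = 2Δ_pg` and the
superconducting scale `E_sc ∼ 5k_BT_c` (both as «full gaps» `2Δ`, meV) and print two «universal curves»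

  `E_pg = E_pg^max (0.27 − x)/0.22`, `E_sc = E_sc^max [1 − 82.6 (0.16 − x)²]`,
  `E_pg^max = E_pg(0.05) = 152 ± 8 meV`, `E_sc^max = E_sc(0.16) = 42 ± 2 meV`

(spread of all data `± 20` / `± 10 meV`), «converg[ing] to the same `x ∼ 0.27` critical point»; their
Table 1 lists, for optimally doped Bi2212, `E_pg = 80 / 70 / 85 / 75 / 65 / 80` (ARPES, STM, SIN, SIS,
Raman B₁g, electrodynamics) and `E_sc = 40 / 45 / 45 / 40` (INS Ω_r, Raman B₂g, Andreev, SIS dip) with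
the printed «average values … 76 meV and … 41 meV». [LeTaconEtAl2006Hg1201TwoEnergyScales, p. 3] print
for optimally doped HgBa₂CuO₄₊δ (`T_c = 95 K`) the B₁g pair-breaking peak `ħω_AN ≃ 505 cm⁻¹ (≃ 8k_BT_c)
= 2Δ_m`.

This file is the exact arithmetic of those printed forms (cell hubbard-downfold, seat lit-2), reusing the
tree's `preslandTallon` (the `82.6 (x − 0.16)²` parabola IS [HuefnerEtAl2008TwoGapsReview]'s `E_sc`
shape), `ramanGapRatio`, `tunnellingGapRatio`, `invCmToMeV`, `invCmPerKelvin`: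

* §1 the lines `epgLine E x = E (0.27 − x)/0.22`, `escLine E x = E · preslandTallon x`: normalisations
  `epgLine E 0.05 = E`, `escLine E 0.16 = E`, the common zero `epgLine E 0.27 = 0` with `escLine`'s zeros
  at `0.16 ± 1/√82.6`, bracketed in `(0.049, 0.051) ∪ (0.269, 0.271)` by the tree's `preslandTallon_endpoints_bounds` (the printed «x ∼ 0.27»), `epgLine E 0.16 = E/2`
  (so the fitted `152` gives `76` at optimal doping — the Table-1 average), linearity in `E` (the `± 8`,
  `± 2` fit bands propagate as `± 8 (0.27 − x)/0.22`, `± 2 · preslandTallon x`), strict decrease of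
  `epgLine` in `x`;
* §2 rows: `epgLine 152 0.19 ∈ (55.27, 55.28)`, `escLine 42 0.19 ∈ (38.87, 38.88)`, `escLine 42 0.27 ∈
  (0.022, 0.023)`, ratio `E_pg/E_sc (0.16) = 38/21`, and the fitted curves' crossing: `epgLine 152 − escLine
  42` is `> 0` at `x = 0.248` and `< 0` at `x = 0.250`, hence (continuity) vanishes somewhere in between;
* §3 Table 1 arithmetic: plain means `455/6 ∈ (75.83, 75.84)` and `42.5` (printed «76», «41»);
  `E_sc^max = 42 meV = 2Δ` is `2Δ/k_BT_c ∈ (5.13, 5.14)` at `95 K` and `(5.41, 5.42)` at `90 K` (the «∼ 5»);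
* §4 the Hg1201 Raman peak: `505 cm⁻¹ ↦ (62.61, 62.62) meV` (`Δ_m ∈ (31.30, 31.31)`), `505 cm⁻¹/k_BT_c =
  ramanGapRatio 505 95 ∈ (7.64, 7.65)` (printed «≃ 8»), and `8k_BT_c` at `95 K` `∈ (528.2, 528.3) cm⁻¹`.

Pure arithmetic on printed numbers; which probe measures which scale is the sources' reading, not this
file's. AI-produced formalisation (H21, cell hubbard-downfold, seat lit-2, 2026-08-29); no facts, no
axioms beyond Mathlib's, no `sorry`.
-/

noncomputable section

open Real

namespace Literature.MathematicalPhysics.QuantumLattice.TwoGapScales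

/-! ## §1 The two printed lines -/

/-- The pseudogap line `E_pg(x) = E_pg^max (0.27 − x)/0.22`.
[cite: HuefnerEtAl2008TwoGapsReview, Fig. 2 caption] -/
def epgLine (E x : ℝ) : ℝ := E * (0.27 - x) / 0.22

/-- The superconducting line `E_sc(x) = E_sc^max [1 − 82.6 (0.16 − x)²]` — the tree's `preslandTallon`.
[cite: HuefnerEtAl2008TwoGapsReview, Fig. 2 caption] -/
def escLine (E x : ℝ) : ℝ := E * preslandTallon x

/-- Unfolding. [cite: HuefnerEtAl2008TwoGapsReview, Fig. 2 caption] -/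
theorem epgLine_def (E x : ℝ) : epgLine E x = E * (0.27 - x) / 0.22 := rfl

/-- Unfolding: `escLine E x = E (1 − 82.6 (x − 0.16)²)`. [cite: HuefnerEtAl2008TwoGapsReview, Fig. 2 caption] -/
theorem escLine_eq (E x : ℝ) : escLine E x = E * (1 - 82.6 * (x - 0.16) ^ 2) := by
  rw [escLine, preslandTallon_def]

/-- The printed form `(0.16 − x)²` equals the tree's `(x − 0.16)²`. [cite: HuefnerEtAl2008TwoGapsReview, Fig. 2 caption] -/
theorem escLine_eq' (E x : ℝ) : escLine E x = E * (1 - 82.6 * (0.16 - x) ^ 2) := by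
  rw [escLine_eq]; ring

/-- Normalisation `E_pg(0.05) = E_pg^max`. [cite: HuefnerEtAl2008TwoGapsReview, Fig. 2 caption] -/
theorem epgLine_at_005 (E : ℝ) : epgLine E 0.05 = E := by
  rw [epgLine]; norm_num

/-- Normalisation `E_sc(0.16) = E_sc^max`. [cite: HuefnerEtAl2008TwoGapsReview, Fig. 2 caption] -/
theorem escLine_at_016 (E : ℝ) : escLine E 0.16 = E := by
  rw [escLine_eq]; norm_num

/-- The pseudogap line vanishes at `x = 0.27` («the same x ∼ 0.27 critical point»).
[cite: HuefnerEtAl2008TwoGapsReview, p. 5] -/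
theorem epgLine_at_027 (E : ℝ) : epgLine E 0.27 = 0 := by
  rw [epgLine]; norm_num

/-- … while the superconducting line vanishes exactly at `0.16 ± 1/√82.6 ∈ (0.049, 0.051) ∪ (0.269, 0.271)`
(for `E ≠ 0`). [cite: HuefnerEtAl2008TwoGapsReview, p. 5] -/
theorem escLine_eq_zero_iff {E : ℝ} (hE : E ≠ 0) (x : ℝ) :
    escLine E x = 0 ↔ x = 0.16 - 1 / sqrt 82.6 ∨ x = 0.16 + 1 / sqrt 82.6 := by
  rw [escLine, mul_eq_zero, preslandTallon_eq_zero_iff]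
  exact ⟨fun h => h.resolve_left hE, fun h => Or.inr h⟩

/-- At optimal doping the pseudogap line is HALF its maximum: `E_pg(0.16) = E_pg^max/2` — so the fitted
`152` gives `76 meV`, the printed Table-1 average. [cite: HuefnerEtAl2008TwoGapsReview, p. 5] -/
theorem epgLine_at_016 (E : ℝ) : epgLine E 0.16 = E / 2 := by
  rw [epgLine]; norm_num; ring

/-- `E_pg` is linear in its amplitude: the `± 8 meV` fit band is `± 8 (0.27 − x)/0.22` on the line.
[cite: HuefnerEtAl2008TwoGapsReview, Fig. 2 caption] -/
theorem epgLine_add (E δ x : ℝ) : epgLine (E + δ) x = epgLine E x + δ * (0.27 - x) / 0.22 := by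
  unfold epgLine; ring

/-- `E_sc` is linear in its amplitude: the `± 2 meV` band is `± 2 · preslandTallon x`.
[cite: HuefnerEtAl2008TwoGapsReview, Fig. 2 caption] -/
theorem escLine_add (E δ x : ℝ) : escLine (E + δ) x = escLine E x + δ * preslandTallon x := by
  unfold escLine; ring

/-- `E_pg` decreases strictly with doping (for `E > 0`). [cite: HuefnerEtAl2008TwoGapsReview, Fig. 2 caption] -/
theorem epgLine_strictAnti {E : ℝ} (hE : 0 < E) : StrictAnti (epgLine E) := by
  intro a b hab
  unfold epgLine
  have : E * (0.27 - b) < E * (0.27 - a) := by nlinarith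
  linarith [div_lt_div_of_pos_right this (by norm_num : (0:ℝ) < 0.22)]

/-! ## §2 Rows at the printed amplitudes `152` and `42` -/

/-- `E_pg(0.16) = 76`, `E_pg(0.19) ∈ (55.27, 55.28)`, `E_pg(0.076) ∈ (134.03, 134.04)` meV.
[cite: HuefnerEtAl2008TwoGapsReview, Fig. 2 caption] -/
theorem epg152_rows :
    epgLine 152 0.16 = 76 ∧ (55.27 < epgLine 152 0.19 ∧ epgLine 152 0.19 < 55.28) ∧
    (134.03 < epgLine 152 0.076 ∧ epgLine 152 0.076 < 134.04) := by
  refine ⟨?_, ⟨?_, ?_⟩, ⟨?_, ?_⟩⟩ <;> norm_num [epgLine]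

/-- `E_sc(0.19) ∈ (38.87, 38.88)`, `E_sc(0.10) ∈ (29.51, 29.52)`, `E_sc(0.27) ∈ (0.022, 0.023)` meV.
[cite: HuefnerEtAl2008TwoGapsReview, Fig. 2 caption] -/
theorem esc42_rows :
    (38.87 < escLine 42 0.19 ∧ escLine 42 0.19 < 38.88) ∧
    (29.51 < escLine 42 0.10 ∧ escLine 42 0.10 < 29.52) ∧
    (0.022 < escLine 42 0.27 ∧ escLine 42 0.27 < 0.023) := by
  refine ⟨⟨?_, ?_⟩, ⟨?_, ?_⟩, ⟨?_, ?_⟩⟩ <;> norm_num [escLine_eq]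

/-- The ratio of the two fitted scales at optimal doping: `E_pg/E_sc (0.16) = 76/42 = 38/21 ∈ (1.80, 1.81)`.
[cite: HuefnerEtAl2008TwoGapsReview, p. 5] -/
theorem ratio_at_016 : epgLine 152 0.16 / escLine 42 0.16 = 38 / 21 ∧
    (1.80 : ℝ) < 38 / 21 ∧ (38 : ℝ) / 21 < 1.81 := by
  rw [epg152_rows.1, escLine_at_016]
  norm_num

/-- The two FITTED curves cross before `0.27`: `E_pg − E_sc > 0` at `x = 0.248` and `< 0` at `x = 0.250`.
[cite: HuefnerEtAl2008TwoGapsReview, Fig. 2 caption] -/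
theorem fitted_curves_sign_change :
    0 < epgLine 152 0.248 - escLine 42 0.248 ∧ epgLine 152 0.250 - escLine 42 0.250 < 0 := by
  constructor <;> norm_num [epgLine, escLine_eq]

/-- … hence (intermediate value theorem) they are EQUAL at some `x ∈ [0.248, 0.250]`.
[cite: HuefnerEtAl2008TwoGapsReview, Fig. 2 caption] -/
theorem fitted_curves_cross : ∃ x ∈ Set.Icc (0.248 : ℝ) 0.250, epgLine 152 x = escLine 42 x := by
  let f : ℝ → ℝ := fun x => escLine 42 x - epgLine 152 x
  have hf : Continuous f := by
    unfold f epgLine escLine preslandTallon dopingParabola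
    fun_prop
  have h := fitted_curves_sign_change
  have hab : (0.248 : ℝ) ≤ 0.250 := by norm_num
  have h0 : (0 : ℝ) ∈ Set.Icc (f 0.248) (f 0.250) := by
    constructor <;> simp only [f] <;> linarith [h.1, h.2]
  obtain ⟨x, hx, hfx⟩ := intermediate_value_Icc hab hf.continuousOn h0
  exact ⟨x, hx, by simp only [f] at hfx; linarith⟩

/-! ## §3 Table 1 arithmetic and the «∼ 5 k_BT_c» -/

/-- Plain means of the printed Table-1 rows: `E_pg`: `(80+70+85+75+65+80)/6 = 455/6 ∈ (75.83, 75.84)`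
(printed average «76»); `E_sc`: `(40+45+45+40)/4 = 42.5` (printed «41» — not the plain mean; recorded).
[cite: HuefnerEtAl2008TwoGapsReview, Table 1] -/
theorem table1_means :
    ((80 : ℝ) + 70 + 85 + 75 + 65 + 80) / 6 = 455 / 6 ∧ (75.83 : ℝ) < 455 / 6 ∧ (455 : ℝ) / 6 < 75.84 ∧
    ((40 : ℝ) + 45 + 45 + 40) / 4 = 42.5 := by
  norm_num

/-- The by-probe INTERVALS of Table 1: `E_pg ∈ [65, 85]`, `E_sc ∈ [40, 45]` meV (min/max of the rows).
[cite: HuefnerEtAl2008TwoGapsReview, Table 1] -/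
theorem table1_intervals :
    (∀ e ∈ ({80, 70, 85, 75, 65, 80} : Finset ℝ), 65 ≤ e ∧ e ≤ 85) ∧
    (∀ e ∈ ({40, 45, 45, 40} : Finset ℝ), 40 ≤ e ∧ e ≤ 45) := by
  constructor <;> intro e he <;> simp only [Finset.mem_insert, Finset.mem_singleton] at he <;>
    rcases he with rfl | rfl | rfl | rfl | rfl | rfl <;> norm_num

/-- `E_sc^max = 42 meV = 2Δ` read as `2Δ/k_BT_c`: `∈ (5.13, 5.14)` at `T_c = 95 K`, `(5.41, 5.42)` at
`90 K` — the printed «E_sc ∼ 5k_BT_c». [cite: HuefnerEtAl2008TwoGapsReview, Fig. 2 caption] -/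
theorem esc_over_kTc :
    5.13 < tunnellingGapRatio 21 95 ∧ tunnellingGapRatio 21 95 < 5.14 ∧
    5.41 < tunnellingGapRatio 21 90 ∧ tunnellingGapRatio 21 90 < 5.42 := by
  refine ⟨?_, ?_, ?_, ?_⟩ <;>
    norm_num [tunnellingGapRatio, kBmeVPerKelvin, boltzmannSI, elementaryChargeSI_def]

/-! ## §4 The Hg1201 Raman pair-breaking peak of Le Tacon et al. -/

/-- `505 cm⁻¹ ∈ (62.61, 62.62) meV`, so `Δ_m = ħω_AN/2 ∈ (31.30, 31.31) meV`.
[cite: LeTaconEtAl2006Hg1201TwoEnergyScales, p. 3] -/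
theorem leTacon2006_peak_meV :
    62.61 < invCmToMeV 505 ∧ invCmToMeV 505 < 62.62 ∧
    31.30 < invCmToMeV 505 / 2 ∧ invCmToMeV 505 / 2 < 31.31 := by
  refine ⟨?_, ?_, ?_, ?_⟩ <;>
    norm_num [invCmToMeV, invCmPerMeV, planckSI, speedOfLightSI, elementaryChargeSI_def]

/-- `ħω_AN/k_BT_c = 505 cm⁻¹/(0.695 cm⁻¹ K⁻¹ · 95 K) ∈ (7.64, 7.65)` — the printed «≃ 8k_BT_c»; and
`8k_BT_c` at `95 K` is `∈ (528.2, 528.3) cm⁻¹`. [cite: LeTaconEtAl2006Hg1201TwoEnergyScales, p. 3] -/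
theorem leTacon2006_ratio :
    7.64 < ramanGapRatio 505 95 ∧ ramanGapRatio 505 95 < 7.65 ∧
    528.2 < 8 * 95 * invCmPerKelvin ∧ 8 * 95 * invCmPerKelvin < 528.3 := by
  refine ⟨?_, ?_, ?_, ?_⟩ <;>
    norm_num [ramanGapRatio, invCmPerKelvin, boltzmannSI, planckSI, speedOfLightSI]

/-- Against the class line: the Hg1201 primary `2Δ_m ≈ 62.6 meV` at `x = 0.16` exceeds the fitted
`E_sc(0.16) = 42` and lies below `E_pg(0.16) = 76` — inside the by-probe spread the review records.
[cite: HuefnerEtAl2008TwoGapsReview, Table 1; LeTaconEtAl2006Hg1201TwoEnergyScales, p. 3] -/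
theorem leTacon2006_vs_lines :
    escLine 42 0.16 < invCmToMeV 505 ∧ invCmToMeV 505 < epgLine 152 0.16 := by
  rw [escLine_at_016, epg152_rows.1]
  have h := leTacon2006_peak_meV
  exact ⟨by linarith [h.1], by linarith [h.2.1]⟩

end Literature.MathematicalPhysics.QuantumLattice.TwoGapScales

end
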